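import Summits.Ventures.CertifiedManyBodySolver.Upper.DWaveSourceOpenBoxParticleHole
import Summits.Ventures.CertifiedManyBodySolver.Upper.PartialParticleHoleParity
import Literature.MathematicalPhysics.QuantumLattice.ApproximateEigenvectorLemmas
import HarnessLib

/-!
# The sourced-box CLAIM NODE from a transformed-frame witness

HONEST FRAMING: first certified bounds; not a superconductivity verdict. Nothing here is a number or a row. This file
closes, on the Lean side, the soundness sentence of FORMAT-mpsgf1 (sr-mbsolver-var-4 co-read R9) for the W5 sourced-box
certificates of sr-mbsolver-var-10: a certificate ships an INTEGER vector `ψ̃` of fixed transformed particle number `Ñ`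
(V1) with `⟨ψ̃,ψ̃⟩ > 0` (V3) and certified inequalities for the Rayleigh quotients of the TRANSFORMED operators (V4/V5);
with `W` = Lieb's partial particle–hole unitary of the tree (`partialParticleHole D↓`) the vector
`ψ := W ψ̃ / ‖ψ̃‖` witnesses the five-conjunct claim node of the landed certificate files
(`∃ ψ, HasParity p ψ ∧ ⟨ψ,ψ⟩ = 1 ∧ Re⟨ψ, A_C ψ⟩ ≤ e·ab ∧ n_lo·ab ≤ Re⟨ψ, N ψ⟩ ≤ n_hi·ab`), with parity `p = Ñ + ab`
(`hasParity_partialParticleHole_mulVec`, i.e. `HasParity 0` when `Ñ = ab`). Every hypothesis below is a statement about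
`ψ̃` and the conjugated operators `Wᴴ A_C W`, `Wᴴ N W` — exactly what an exact reader evaluates (the producers' frame
differs from `W` by a diagonal ±1 gauge on the down modes, which changes neither Rayleigh quotients nor supports).
Written by the IRD desk (sr-mbsolver-ird-5); nothing of pin-1's / var-10's files is touched.
-/

noncomputable section
namespace Summit.Ventures.CertifiedManyBodySolver
open Matrix Finset Literature.Probability.LatticeModels
open Literature.MathematicalPhysics.QuantumLattice Literature.MathematicalPhysics.QuantumLattice.TwoCluster
open Literature.Barriers.HubbardSuperconductivity HubbardWave0
open scoped ComplexOrder ComplexConjugate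

section NodeOfWitness

variable {ι : Type*} [LinearOrder ι] [Fintype ι]

omit [LinearOrder ι] in
/-- Conjugated expectation: `⟨Wv, M (Wv)⟩ = ⟨v, (Wᴴ M W) v⟩`. [folklore] -/
theorem star_mulVec_dotProduct_mulVec (W M : Matrix (Finset ι) (Finset ι) ℂ) (v : Fock ι) :
    star (W *ᵥ v) ⬝ᵥ (M *ᵥ (W *ᵥ v)) = star v ⬝ᵥ ((Wᴴ * M * W) *ᵥ v) := by
  rw [star_mulVec, ← dotProduct_mulVec, mulVec_mulVec, mulVec_mulVec, Matrix.mul_assoc]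

omit [LinearOrder ι] in
/-- Real scaling of an expectation: `⟨c v, M (c v)⟩ = c² ⟨v, M v⟩` for real `c`. [folklore] -/
theorem star_smul_dotProduct_mulVec_smul (c : ℝ) (M : Matrix (Finset ι) (Finset ι) ℂ) (v : Fock ι) :
    star (((c : ℝ) : ℂ) • v) ⬝ᵥ (M *ᵥ (((c : ℝ) : ℂ) • v)) = ((c * c : ℝ) : ℂ) * (star v ⬝ᵥ (M *ᵥ v)) := by
  rw [star_smul, mulVec_smul, smul_dotProduct, dotProduct_smul, smul_smul, smul_eq_mul, Complex.star_def,
    Complex.conj_ofReal, Complex.ofReal_mul]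

omit [LinearOrder ι] [Fintype ι] in
/-- Scalar multiples keep the parity support. [folklore] -/
theorem hasParity_smul {p : ℕ} {x : Fock ι} (c : ℂ) (hx : HasParity p x) : HasParity p (c • x) :=
  fun s hs => hx s (fun h => hs (by rw [Pi.smul_apply, h, smul_zero]))

/-- The down-spin orbitals of the open box number `a·b`. [folklore] -/
theorem card_spinDownOrbitals_box (a b : ℕ) :
    (spinDownOrbitals : Finset (Orb (Fin a ×ₗ Fin b))).card = a * b := by
  have h : (spinDownOrbitals : Finset (Orb (Fin a ×ₗ Fin b))) =
      Finset.univ.map ⟨fun x : Fin a ×ₗ Fin b => orb x 1, fun x y hxy => by simpa [orb] using hxy⟩ := by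
    ext o
    simp only [Finset.mem_map, Finset.mem_univ, true_and, Function.Embedding.coeFn_mk]
    constructor
    · intro ho
      refine ⟨(ofLex o).1, ?_⟩
      have h2 : (ofLex o).2 = 1 := by simpa [spinDownOrbitals] using ho
      simp only [orb]
      rw [← h2]
      exact toLex_ofLex o
    · rintro ⟨x, rfl⟩
      exact (orb_mem_spinDownOrbitals_iff x 1).2 rfl
  rw [h, Finset.card_map, Finset.card_univ]
  simp [Fintype.card_prod]

variable (a b : ℕ)

/-- **The claim node from a transformed-frame witness.** Let `W = partialParticleHole D↓` on the open `a × b` box,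
`A = dWaveSourceOpenBox a b U μ h`, `N = totalNumber`, and let `ψ̃` be an `Ñ`-particle vector (FORMAT-mpsgf1 §2 V1) with
`⟨ψ̃,ψ̃⟩ > 0` (V3) such that `Re⟨ψ̃, (WᴴAW)ψ̃⟩ ≤ e·ab·⟨ψ̃,ψ̃⟩` and `n_lo·ab·⟨ψ̃,ψ̃⟩ ≤ Re⟨ψ̃, (WᴴNW)ψ̃⟩ ≤ n_hi·ab·⟨ψ̃,ψ̃⟩`
(the certified Rayleigh-quotient rows, cleared of denominators). Then `ψ := W ψ̃/‖ψ̃‖` is a unit vector of parity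
`Ñ + ab` with `Re⟨ψ, Aψ⟩ ≤ e·ab` and `n_lo·ab ≤ Re⟨ψ, Nψ⟩ ≤ n_hi·ab` — the five-conjunct sourced-box claim node
(`HasParity 0` when `Ñ = ab`, by `HasParity.mono`). [cite: Lieb1989, proof of Theorem 2] -/
theorem sourcedBoxNode_of_transformedWitness (U μ h : ℝ) (e nlo nhi : ℚ) {Nt : ℕ}
    (ψt : Fock (Orb (Fin a ×ₗ Fin b))) (hN : IsNParticle Nt ψt) (hpos : 0 < (star ψt ⬝ᵥ ψt).re)
    (hE : (star ψt ⬝ᵥ (((partialParticleHole (spinDownOrbitals : Finset (Orb (Fin a ×ₗ Fin b))))ᴴ *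
            dWaveSourceOpenBox a b U μ h * partialParticleHole (spinDownOrbitals : Finset (Orb (Fin a ×ₗ Fin b)))) *ᵥ ψt)).re
          ≤ (e : ℝ) * ((a : ℝ) * b) * (star ψt ⬝ᵥ ψt).re)
    (hlo : (nlo : ℝ) * ((a : ℝ) * b) * (star ψt ⬝ᵥ ψt).re ≤
          (star ψt ⬝ᵥ (((partialParticleHole (spinDownOrbitals : Finset (Orb (Fin a ×ₗ Fin b))))ᴴ *
            totalNumber * partialParticleHole (spinDownOrbitals : Finset (Orb (Fin a ×ₗ Fin b)))) *ᵥ ψt)).re)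
    (hhi : (star ψt ⬝ᵥ (((partialParticleHole (spinDownOrbitals : Finset (Orb (Fin a ×ₗ Fin b))))ᴴ *
            totalNumber * partialParticleHole (spinDownOrbitals : Finset (Orb (Fin a ×ₗ Fin b)))) *ᵥ ψt)).re
          ≤ (nhi : ℝ) * ((a : ℝ) * b) * (star ψt ⬝ᵥ ψt).re) :
    ∃ ψ : Fock (Orb (Fin a ×ₗ Fin b)), HasParity (Nt + a * b) ψ ∧ star ψ ⬝ᵥ ψ = 1 ∧
      (star ψ ⬝ᵥ (dWaveSourceOpenBox a b U μ h *ᵥ ψ)).re ≤ ((e : ℚ) : ℝ) * ((a : ℝ) * b) ∧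
      ((nlo : ℚ) : ℝ) * ((a : ℝ) * b) ≤ (star ψ ⬝ᵥ (totalNumber *ᵥ ψ)).re ∧
      (star ψ ⬝ᵥ (totalNumber *ᵥ ψ)).re ≤ ((nhi : ℚ) : ℝ) * ((a : ℝ) * b) := by
  set D : Finset (Orb (Fin a ×ₗ Fin b)) := spinDownOrbitals with hD
  set W : Matrix (Finset (Orb (Fin a ×ₗ Fin b))) (Finset (Orb (Fin a ×ₗ Fin b))) ℂ := partialParticleHole D with hW
  set R : ℝ := (star ψt ⬝ᵥ ψt).re with hR
  have hRne : R ≠ 0 := ne_of_gt hpos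
  -- `⟨ψ̃,ψ̃⟩` is the real number `R`
  have hself : star ψt ⬝ᵥ ψt = (R : ℂ) := by
    rw [star_dotProduct_self_eq_eucNorm_sq, hR, ← eucNorm_sq]
  -- unitarity: `⟨Wψ̃, Wψ̃⟩ = ⟨ψ̃,ψ̃⟩`
  have hWW : Wᴴ * W = 1 := partialParticleHole_conjTranspose_mul D
  have hunit : star (W *ᵥ ψt) ⬝ᵥ (W *ᵥ ψt) = (R : ℂ) := by
    rw [star_mulVec, ← dotProduct_mulVec, mulVec_mulVec, hWW, one_mulVec, hself]
  set c : ℝ := 1 / Real.sqrt R with hc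
  have hcc : c * c = 1 / R := by
    rw [hc, div_mul_div_comm, one_mul, Real.mul_self_sqrt hpos.le]
  refine ⟨((c : ℝ) : ℂ) • (W *ᵥ ψt), ?_, ?_, ?_, ?_, ?_⟩
  · -- parity
    have hp := hasParity_partialParticleHole_mulVec D (hasParity_of_isNParticle hN)
    rw [hD, card_spinDownOrbitals_box] at hp
    exact hasParity_smul _ (by simpa [hW, hD] using hp)
  · -- normalisation
    have := star_smul_dotProduct_mulVec_smul c (1 : Matrix _ _ ℂ) (W *ᵥ ψt)
    rw [one_mulVec, one_mulVec] at this
    rw [this, hcc, hunit, ← Complex.ofReal_mul, div_mul_cancel₀ _ hRne, Complex.ofReal_one]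
  · -- energy
    rw [star_smul_dotProduct_mulVec_smul, star_mulVec_dotProduct_mulVec, Complex.re_ofReal_mul, hcc]
    have h1 : 1 / R * (star ψt ⬝ᵥ ((Wᴴ * dWaveSourceOpenBox a b U μ h * W) *ᵥ ψt)).re ≤ 1 / R * ((e : ℝ) * ((a : ℝ) * b) * R) :=
      mul_le_mul_of_nonneg_left hE (by positivity)
    calc 1 / R * (star ψt ⬝ᵥ ((Wᴴ * dWaveSourceOpenBox a b U μ h * W) *ᵥ ψt)).re
        ≤ 1 / R * ((e : ℝ) * ((a : ℝ) * b) * R) := h1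
      _ = ((e : ℚ) : ℝ) * ((a : ℝ) * b) := by field_simp
  · -- density, lower
    rw [star_smul_dotProduct_mulVec_smul, star_mulVec_dotProduct_mulVec, Complex.re_ofReal_mul, hcc]
    have h1 : 1 / R * ((nlo : ℝ) * ((a : ℝ) * b) * R) ≤ 1 / R * (star ψt ⬝ᵥ ((Wᴴ * totalNumber * W) *ᵥ ψt)).re :=
      mul_le_mul_of_nonneg_left hlo (by positivity)
    calc ((nlo : ℚ) : ℝ) * ((a : ℝ) * b) = 1 / R * ((nlo : ℝ) * ((a : ℝ) * b) * R) := by field_simp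
      _ ≤ 1 / R * (star ψt ⬝ᵥ ((Wᴴ * totalNumber * W) *ᵥ ψt)).re := h1
  · -- density, upper
    rw [star_smul_dotProduct_mulVec_smul, star_mulVec_dotProduct_mulVec, Complex.re_ofReal_mul, hcc]
    have h1 : 1 / R * (star ψt ⬝ᵥ ((Wᴴ * totalNumber * W) *ᵥ ψt)).re ≤ 1 / R * ((nhi : ℝ) * ((a : ℝ) * b) * R) :=
      mul_le_mul_of_nonneg_left hhi (by positivity)
    calc 1 / R * (star ψt ⬝ᵥ ((Wᴴ * totalNumber * W) *ᵥ ψt)).re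
        ≤ 1 / R * ((nhi : ℝ) * ((a : ℝ) * b) * R) := h1
      _ = ((nhi : ℚ) : ℝ) * ((a : ℝ) * b) := by field_simp

/-- **The TWO-FIELD claim node from a transformed-frame witness** (hubbard-cq-obsth-2's seven-conjunct shape: the five
conjuncts above AND the zero-field energy window `e0lo·ab ≤ Re⟨ψ, A_C(μ,0)ψ⟩ ≤ e0hi·ab` of the SAME vector). Same
`ψ := Wψ̃/‖ψ̃‖`; the two extra hypotheses are the cleared Rayleigh rows for `Wᴴ A_C(μ,0) W` (for an exact reader:
`E_mu0 + κ·X`, FORMAT-mpsgf1 `observables`). [cite: Lieb1989, proof of Theorem 2] -/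
theorem sourcedBoxTwoFieldNode_of_transformedWitness (U μ h : ℝ) (e nlo nhi e0lo e0hi : ℚ) {Nt : ℕ}
    (ψt : Fock (Orb (Fin a ×ₗ Fin b))) (hN : IsNParticle Nt ψt) (hpos : 0 < (star ψt ⬝ᵥ ψt).re)
    (hE : (star ψt ⬝ᵥ (((partialParticleHole (spinDownOrbitals : Finset (Orb (Fin a ×ₗ Fin b))))ᴴ *
            dWaveSourceOpenBox a b U μ h * partialParticleHole (spinDownOrbitals : Finset (Orb (Fin a ×ₗ Fin b)))) *ᵥ ψt)).re
          ≤ (e : ℝ) * ((a : ℝ) * b) * (star ψt ⬝ᵥ ψt).re)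
    (hlo : (nlo : ℝ) * ((a : ℝ) * b) * (star ψt ⬝ᵥ ψt).re ≤
          (star ψt ⬝ᵥ (((partialParticleHole (spinDownOrbitals : Finset (Orb (Fin a ×ₗ Fin b))))ᴴ *
            totalNumber * partialParticleHole (spinDownOrbitals : Finset (Orb (Fin a ×ₗ Fin b)))) *ᵥ ψt)).re)
    (hhi : (star ψt ⬝ᵥ (((partialParticleHole (spinDownOrbitals : Finset (Orb (Fin a ×ₗ Fin b))))ᴴ *
            totalNumber * partialParticleHole (spinDownOrbitals : Finset (Orb (Fin a ×ₗ Fin b)))) *ᵥ ψt)).re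
          ≤ (nhi : ℝ) * ((a : ℝ) * b) * (star ψt ⬝ᵥ ψt).re)
    (h0lo : (e0lo : ℝ) * ((a : ℝ) * b) * (star ψt ⬝ᵥ ψt).re ≤
          (star ψt ⬝ᵥ (((partialParticleHole (spinDownOrbitals : Finset (Orb (Fin a ×ₗ Fin b))))ᴴ *
            dWaveSourceOpenBox a b U μ 0 * partialParticleHole (spinDownOrbitals : Finset (Orb (Fin a ×ₗ Fin b)))) *ᵥ ψt)).re)
    (h0hi : (star ψt ⬝ᵥ (((partialParticleHole (spinDownOrbitals : Finset (Orb (Fin a ×ₗ Fin b))))ᴴ *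
            dWaveSourceOpenBox a b U μ 0 * partialParticleHole (spinDownOrbitals : Finset (Orb (Fin a ×ₗ Fin b)))) *ᵥ ψt)).re
          ≤ (e0hi : ℝ) * ((a : ℝ) * b) * (star ψt ⬝ᵥ ψt).re) :
    ∃ ψ : Fock (Orb (Fin a ×ₗ Fin b)), HasParity (Nt + a * b) ψ ∧ star ψ ⬝ᵥ ψ = 1 ∧
      (star ψ ⬝ᵥ (dWaveSourceOpenBox a b U μ h *ᵥ ψ)).re ≤ ((e : ℚ) : ℝ) * ((a : ℝ) * b) ∧
      ((nlo : ℚ) : ℝ) * ((a : ℝ) * b) ≤ (star ψ ⬝ᵥ (totalNumber *ᵥ ψ)).re ∧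
      (star ψ ⬝ᵥ (totalNumber *ᵥ ψ)).re ≤ ((nhi : ℚ) : ℝ) * ((a : ℝ) * b) ∧
      ((e0lo : ℚ) : ℝ) * ((a : ℝ) * b) ≤ (star ψ ⬝ᵥ (dWaveSourceOpenBox a b U μ 0 *ᵥ ψ)).re ∧
      (star ψ ⬝ᵥ (dWaveSourceOpenBox a b U μ 0 *ᵥ ψ)).re ≤ ((e0hi : ℚ) : ℝ) * ((a : ℝ) * b) := by
  set D : Finset (Orb (Fin a ×ₗ Fin b)) := spinDownOrbitals with hD
  set W : Matrix (Finset (Orb (Fin a ×ₗ Fin b))) (Finset (Orb (Fin a ×ₗ Fin b))) ℂ := partialParticleHole D with hW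
  set R : ℝ := (star ψt ⬝ᵥ ψt).re with hR
  have hRne : R ≠ 0 := ne_of_gt hpos
  have hself : star ψt ⬝ᵥ ψt = (R : ℂ) := by
    rw [star_dotProduct_self_eq_eucNorm_sq, hR, ← eucNorm_sq]
  have hWW : Wᴴ * W = 1 := partialParticleHole_conjTranspose_mul D
  have hunit : star (W *ᵥ ψt) ⬝ᵥ (W *ᵥ ψt) = (R : ℂ) := by
    rw [star_mulVec, ← dotProduct_mulVec, mulVec_mulVec, hWW, one_mulVec, hself]
  set c : ℝ := 1 / Real.sqrt R with hc
  have hcc : c * c = 1 / R := by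
    rw [hc, div_mul_div_comm, one_mul, Real.mul_self_sqrt hpos.le]
  -- generic «cleared row ⇒ normalised row» steps
  have up : ∀ (M : Matrix _ _ ℂ) (q : ℚ), (star ψt ⬝ᵥ ((Wᴴ * M * W) *ᵥ ψt)).re ≤ (q : ℝ) * ((a : ℝ) * b) * R →
      (star (((c : ℝ) : ℂ) • (W *ᵥ ψt)) ⬝ᵥ (M *ᵥ (((c : ℝ) : ℂ) • (W *ᵥ ψt)))).re ≤ ((q : ℚ) : ℝ) * ((a : ℝ) * b) := by
    intro M q hM
    rw [star_smul_dotProduct_mulVec_smul, star_mulVec_dotProduct_mulVec, Complex.re_ofReal_mul, hcc]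
    calc 1 / R * (star ψt ⬝ᵥ ((Wᴴ * M * W) *ᵥ ψt)).re ≤ 1 / R * ((q : ℝ) * ((a : ℝ) * b) * R) :=
          mul_le_mul_of_nonneg_left hM (by positivity)
      _ = ((q : ℚ) : ℝ) * ((a : ℝ) * b) := by field_simp
  have dn : ∀ (M : Matrix _ _ ℂ) (q : ℚ), (q : ℝ) * ((a : ℝ) * b) * R ≤ (star ψt ⬝ᵥ ((Wᴴ * M * W) *ᵥ ψt)).re →
      ((q : ℚ) : ℝ) * ((a : ℝ) * b) ≤ (star (((c : ℝ) : ℂ) • (W *ᵥ ψt)) ⬝ᵥ (M *ᵥ (((c : ℝ) : ℂ) • (W *ᵥ ψt)))).re := by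
    intro M q hM
    rw [star_smul_dotProduct_mulVec_smul, star_mulVec_dotProduct_mulVec, Complex.re_ofReal_mul, hcc]
    calc ((q : ℚ) : ℝ) * ((a : ℝ) * b) = 1 / R * ((q : ℝ) * ((a : ℝ) * b) * R) := by field_simp
      _ ≤ 1 / R * (star ψt ⬝ᵥ ((Wᴴ * M * W) *ᵥ ψt)).re := mul_le_mul_of_nonneg_left hM (by positivity)
  refine ⟨((c : ℝ) : ℂ) • (W *ᵥ ψt), ?_, ?_, up _ _ hE, dn _ _ hlo, up _ _ hhi, dn _ _ h0lo, up _ _ h0hi⟩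
  · have hp := hasParity_partialParticleHole_mulVec D (hasParity_of_isNParticle hN)
    rw [hD, card_spinDownOrbitals_box] at hp
    exact hasParity_smul _ (by simpa [hW, hD] using hp)
  · have := star_smul_dotProduct_mulVec_smul c (1 : Matrix _ _ ℂ) (W *ᵥ ψt)
    rw [one_mulVec, one_mulVec] at this
    rw [this, hcc, hunit, ← Complex.ofReal_mul, div_mul_cancel₀ _ hRne, Complex.ofReal_one]

end NodeOfWitness
end Summit.Ventures.CertifiedManyBodySolver
end
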